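import Summits.Ventures.Crystal3D.Kissing125.SearchCheck2
import HarnessLib

/-!
# The growth-search checker (computable part) — K25 copy at `κ = 7/32` (`h = 5/4`), part 3/3

HONEST FRAMING (cell pub-crystal3d, K-path at `h = 5/4`): this is NOT a result printed by Hales.  It is his
METHOD (arXiv:1209.6043, Theorem 3: the main estimate + the classification of the contact graphs of kissing
configurations, in the tree's form of a verified interval-arithmetic growth search, `Literature/…/KissingSearch*.lean`)
RE-RUN at the separation `5/2` instead of `2h₀ = 2.52` (largest long-side cosine `κ = 1 − (5/4)²/2 = 7/32` instead of
`κ₀ = 1031/5000`).  The declarations are namespace-shadowing COPIES of the tree's declarations (same names, inside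
`namespace Summit.Ventures.Crystal3D.Kissing125[.KissingSearch]`, original docstrings and citation tags kept — the tags
name the printed METHOD step each declaration implements); the diff to the originals is stated per file.  Generated by
`HOME/lean/kissing125/gen/mkfiles.py`; audit recipe in `HOME/lean/kissing125/README.md`.  Nothing here is asserted
about GAP(1.26) or any census.

THIS FILE: copy of `Literature/Geometry/DiscreteGeometry/KissingSearchCheck.lean` with EXACTLY ONE semantic change, `def κ0 : ℚ := 7 / 32` (was `1031 / 5000`); everything else (cells `K = 15`, `δ = 1/2048`, tables, rules, roots, parts) byte-identical up to the namespace line.  (Part 3 of 3: lines 645–680 of the transformed copy; the split is only for the 400-line rule.)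

## References
* T. C. Hales, *A proof of Fejes Tóth's conjecture on sphere packings with kissing number twelve*,
  arXiv:1209.6043 (2012): Definition 1, Theorem 2 (main estimate `d₃`), Theorem 3, Lemmas 7–10. [`Hales2012`]
* R. E. Moore, *Interval Analysis* (1966), Theorem 3.1, §4.4. [`Moore1966`]
-/

namespace Summit.Ventures.Crystal3D.Kissing125
open Literature.Geometry.DiscreteGeometry

namespace KissingSearch
open Literature.Analysis.ValidatedNumerics KissingLP

/-- Expand every node of a list one level: `none` if a leaf is `false`; decided `true` leaves
disappear; internal nodes are replaced by their children. [folklore] -/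
def stepAll : List (St × List ℕ) → Option (List (St × List ℕ))
  | [] => some []
  | p :: rest =>
    match p.1.expand p.2 with
    | .leaf true => stepAll rest
    | .leaf false => none
    | .branch kids => (stepAll rest).map fun L => kids ++ L

/-- The frontier at depth `k`. [folklore] -/
def frontier (L : List (St × List ℕ)) : ℕ → Option (List (St × List ℕ))
  | 0 => some L
  | k + 1 =>
    match stepAll L with
    | none => none
    | some L' => frontier L' k

/-- Attach indices. [folklore] -/
def indexed {α : Type} (L : List α) : List (ℕ × α) := (List.range L.length).zip L

/-- **Part `i` of `parts` of the whole computation**: the nodes of the frontier at depth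
`depth` whose index is `≡ i (mod parts)` are searched with fuel `fuel`. [folklore] -/
def checkPart (depth parts i fuel : ℕ) : Bool :=
  match frontier rootStates depth with
  | none => false
  | some L => (indexed L).all fun p => p.1 % parts != i || p.2.1.search p.2.2 fuel

/-- The whole computation in one piece (for reference; the run is split into parts).
[folklore] -/
def checkAll (fuel : ℕ) : Bool := rootStates.all fun p => p.1.search p.2 fuel

end KissingSearch

end Summit.Ventures.Crystal3D.Kissing125


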